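/-
Copyright (c) 2026 the pub-hodgecm-mathlib formalisation cell (harness21).  Prover seat hodgecm-mathlib-K2E1-p12 (g3), Track B ∕ K2-LIT, h413 = `stmt-HodgeConjecture-24833`,
route of record `HCCMUnconditional`, ROADCARD «5Res ENDGAME BY FAMILIES» AMENDMENT #3 «GENERAL (U,τ) LADDER» rung G1; dealer K2E1-plan (g7) ruling (267) — FILE F3d-β_τ of the C7_τ
chain: a `χ`-ISOTYPIC NICE FUNCTION ON `N(𝔸)B(F)∖G(𝔸)` THAT IS RIGHT-`(K′, ω)`-EQUIVARIANT IS A FINITE SUM OF PURE TENSORS `f(H)·φ`, `φ ∈ chiSectionSpace χ K′ ω` — the `K_∞`-type twin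
of ★ F3d-β `K2E1ChiIsotypicPureTensorDecompositionU2` (K2E1-p10 (g2)); the stabiliser dichotomy becomes `χ(β₀₀) = ω(k)` on `β w = w k`.
-/
import Summits.HodgeConjecture.HodgeConjecture.Theorems.K2E1ChiIsotypicPureTensorDecompositionU2   -- ★ F3d-β (τ = 1): stabiliser algebra `ideleNorm_firstEntryUnit_eq_one_of_mul_eq`, `firstEntryUnit_conj∕_inv_mul∕_mul∕_inv`; brings ★ DEFS, ★ bridge, ★ torus ray
import HarnessLib

/-!
# h413 ∕ Track B «K2-LIT», ROADCARD «5Res BY FAMILIES» AMENDMENT #3 rung G1, FILE F3d-β_τ — helper `K2E1PseudoEisensteinChiSectionStabiliserKTypeU2`: a right-`(K′, ω)`-EQUIVARIANT `ψ` on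
# `U(J₂)(𝔸_F)` (`ψ(g k) = ω(k) ψ(g)`, `ω` a continuous unitary character of `K′`) that is `χ`-ISOTYPIC under the norm-one Borel (`ψ(b g) = χ(b₀₀) ψ(g)` whenever `‖b₀₀‖ = 1`), with `χ` trivial
# on the real ray, continuous and supported in a height band, IS A FINITE SUM `ψ = Σ_q f_q(H)·φ_q` OF PURE TENSORS with `f_q ∈ C_c((0,∞))` and `φ_q ∈ chiSectionSpace χ K′ ω` continuous

Cell `pub/hodgecm-mathlib`, crux h413 = `stmt-HodgeConjecture-24833`, route of record `HCCMUnconditional`; dealer K2E1-plan (g7) (267); consumer: the C7_τ HEAD_τ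
`K2E1PseudoEisensteinFamilyDecompositionKTypeU2` (whoever of K2E4-p14 ∕ this seat reaches it first), fed by ★ (α)_τ p860819 `K2E1NormOneTorusFamilyApproxKTypeU2` whose output pieces
`P_χ` are exactly this file's `ψ` (continuous, right-`(K′, ω)`-equivariant, left-`B(F)`-invariant, norm-one-Borel `χ`-isotypic, band-limited).  THEOREMS ONLY (no `def`, no `instance`, no
notation, no named-fact hypothesis, no `sorry`); lane `--supports stmt-HodgeConjecture-24833 --as helper` (count-neutral).  Closes no socket.  Generic quadratic datum `(F, E, c)` with
`c² = 1`, `U(J₂)`; `K′` an OPEN subgroup of `G(𝔸)` on which the Borel height is right-invariant (`hHK′`) with FINITELY MANY `(B(𝔸), K′)`-double cosets (`hBK`); `χ : HeckeCharacter E` with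
`χ(z_E(r)) = 1` on the positive real ray (`hχray`); the `K′`-TYPE `ω : K′ → ℂ` is a bare function (the currency of ★ `chiSectionSpace χ K′ ω`) assumed MULTIPLICATIVE (`hωmul`), UNITARY
(`hω1 : ‖ω k‖ = 1`) and CONTINUOUS (`hωc`) — a `K_∞ ≅ U(1)×U(1)`-character extended by `1` on an open compact `U_f` is the case in point.

THE MATHEMATICS ([MoeglinWaldspurger1995, I.2.17, II.1.1]; [GelbartJacquet1979Corvallis, §3]; [Garrett2018, §2.2]) — VERBATIM ★ F3d-β with the `K′`-law twisted.  On a double coset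
`d = B(𝔸) w K′` write `g = β w k`.  (i) The STABILISER `B_w = {β ∈ B(𝔸) : β w ∈ w K′}` consists of norm-one elements (★ `ideleNorm_firstEntryUnit_eq_one_of_mul_eq`), so if `ψ ≢ 0` on `d`
then **`χ(β₀₀) = ω(k)` whenever `β w = w k`** (`ψ(β₀βw) = ψ(β₀wk) = ω(k)ψ(β₀w)` by equivariance and `= χ(β₀₀)ψ(β₀w)` by isotypy at `β₀ββ₀⁻¹`): hence `φ_d(βwk) := χ(β₀₀)·ω(k)` is WELL
DEFINED (§1, `ω` multiplicative and unitary), a `χ`-section with `φ_d(g k) = ω(k)φ_d(g)`, zero off `d`, and CONTINUOUS (on the open `g₀K′` it is `ω(g₀⁻¹g)·φ_d(g₀)`, `ω` continuous —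
§1 `continuous_of_mul_kType_isOpen`).  (ii) `f_d(h) := ψ(ρ(s_h) w)`, `s_h = log(h∕H(w))∕[E:ℚ]`, exactly as in ★ F3d-β (the diagonal ray ★ `exists_torusRay_two`).  (iii) For `g = βwk`:
`ψ(g) = ω(k)ψ(βw) = ω(k)χ(β₀₀)ψ(ρ(s)w) = φ_d(g)·f_d(H(g))`.  Summing over the finitely many double cosets gives `ψ = Σ_d f_d(H)·φ_d` with termwise domination `|f_d(H)φ_d| ≤ |ψ|`.

* §1 `continuous_of_mul_kType_isOpen` (right-`(K′,ω)`-equivariant ⇒ continuous), `kType_inv`, `chi_firstEntryUnit_eq_kType_of_apply_ne_zero` (the dichotomy `χ(β₀₀) = ω(k)`),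
  `chi_mul_kType_eq_of_eq` (well-definedness of `χ(β₀₀)·ω(k)`).
* §2 **`exists_pureTensor_on_doubleCoset_kType`** (one double coset).  §3 **`exists_sum_pureTensor_eq_norm_le_kType`** (the decomposition with termwise domination; index type finite).

HONEST LABEL: HC_CM is proved only modulo the 7 printed citations (2 remaining named inputs: hLiu418 = `stmt-HodgeConjecture-24832`, h413 = `stmt-HodgeConjecture-24833`) until rung 0
closes; this file asserts no named fact and closes no socket.
References: [MoeglinWaldspurger1995] C. Mœglin, J.-L. Waldspurger, *Spectral Decomposition and Eisenstein Series*, I.2.17, II.1.1; [GelbartJacquet1979Corvallis] S. Gelbart, H. Jacquet,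
*Forms of GL(2) from the analytic point of view*, §3; [Garrett2018] P. Garrett, *Modern Analysis of Automorphic Forms by Example*, §2.2; [Rogawski1990] J. Rogawski, *Automorphic
Representations of Unitary Groups in Three Variables*, §1.10, §2.2.
-/

set_option autoImplicit false
set_option linter.dupNamespace false  -- the mandated namespace repeats the summit's segment (`HodgeConjecture.HodgeConjecture`)

noncomputable section

open MeasureTheory Set Filter Topology NumberField
open Literature.NumberTheory.Automorphic Literature.NumberTheory.Automorphic.UnitaryGroup Literature.NumberTheory.GaloisRepresentations
open Summit.HodgeConjecture.HodgeConjecture.Cruxes.H413.K2E1CharacterEisensteinU2Defs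
open Summit.HodgeConjecture.HodgeConjecture.Cruxes.H413.K2E1ChiSectionSpaceU2Defs
open Summit.HodgeConjecture.HodgeConjecture.Cruxes.H413.K2E1ChiSectionBridgeU2 (borelHeight_borel_mul_eq_ideleNorm_firstEntryUnit_mul)
open scoped NNReal

open Summit.HodgeConjecture.HodgeConjecture.Cruxes.H413.K2E1ChiIsotypicPureTensorDecompositionU2 (ideleNorm_firstEntryUnit_eq_one_of_mul_eq firstEntryUnit_conj firstEntryUnit_inv_mul
  firstEntryUnit_inv)

namespace Summit.HodgeConjecture.HodgeConjecture.Cruxes.H413.K2E1PseudoEisensteinChiSectionStabiliserKTypeU2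

variable {F E : Type} [Field F] [NumberField F] [Field E] [NumberField E] [Algebra F E] {c : E ≃ₐ[F] E}

/-! ## §1 Continuity of `(K′, ω)`-equivariant functions; the dichotomy `χ(β₀₀) = ω(k)`; well-definedness -/

/-- **A RIGHT-`(K′, ω)`-EQUIVARIANT FUNCTION IS CONTINUOUS WHEN `K′` IS OPEN AND `ω` IS CONTINUOUS**: on the open set `g₀K′` it is `g ↦ ω(g₀⁻¹ g)·φ(g₀)`. [folklore] -/
theorem continuous_of_mul_kType_isOpen {K' : Subgroup (quasiSplit F E c 2).Adelic} (hK'o : IsOpen (K' : Set (quasiSplit F E c 2).Adelic))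
    {ω : ↥K' → ℂ} (hωc : Continuous ω) {φ : (quasiSplit F E c 2).Adelic → ℂ}
    (hφ : ∀ (g : (quasiSplit F E c 2).Adelic) (k : ↥K'), φ (g * (k : (quasiSplit F E c 2).Adelic)) = ω k * φ g) : Continuous φ := by
  refine continuous_iff_continuousAt.2 fun g₀ => ?_
  have hU : IsOpen ((fun k => g₀ * k) '' (K' : Set (quasiSplit F E c 2).Adelic)) := (Homeomorph.mulLeft g₀).isOpenMap _ hK'o
  have hmem : g₀ ∈ (fun k => g₀ * k) '' (K' : Set (quasiSplit F E c 2).Adelic) := ⟨1, K'.one_mem, mul_one g₀⟩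
  have hK : ∀ x : ↥((fun k => g₀ * k) '' (K' : Set (quasiSplit F E c 2).Adelic)), g₀⁻¹ * (x : (quasiSplit F E c 2).Adelic) ∈ K' := by
    rintro ⟨_, k, hk, rfl⟩
    rw [inv_mul_cancel_left]
    exact hk
  have hon : ContinuousOn φ ((fun k => g₀ * k) '' (K' : Set (quasiSplit F E c 2).Adelic)) := by
    rw [continuousOn_iff_continuous_restrict]
    have heq : ((fun k => g₀ * k) '' (K' : Set (quasiSplit F E c 2).Adelic)).restrict φ =
        fun x : ↥((fun k => g₀ * k) '' (K' : Set (quasiSplit F E c 2).Adelic)) => ω ⟨g₀⁻¹ * (x : (quasiSplit F E c 2).Adelic), hK x⟩ * φ g₀ := by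
      funext x
      have h := hφ g₀ ⟨g₀⁻¹ * (x : (quasiSplit F E c 2).Adelic), hK x⟩
      rw [Subgroup.coe_mk, mul_inv_cancel_left] at h
      exact h
    rw [heq]
    exact (hωc.comp (Continuous.subtype_mk (continuous_const.mul continuous_subtype_val) _)).mul continuous_const
  exact hon.continuousAt (hU.mem_nhds hmem)

/-- A multiplicative unitary `ω : K′ → ℂ` inverts: `ω(k⁻¹) = (ω k)⁻¹` (and `ω 1 = 1`, `ω k ≠ 0`). [folklore] -/
theorem kType_inv {K' : Subgroup (quasiSplit F E c 2).Adelic} {ω : ↥K' → ℂ} (hωmul : ∀ k k' : ↥K', ω (k * k') = ω k * ω k') (hω1 : ∀ k : ↥K', ‖ω k‖ = 1) (k : ↥K') :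
    ω k⁻¹ = (ω k)⁻¹ := by
  have hk0 : ω k ≠ 0 := fun h => by simpa [h] using hω1 k
  have h1 : ω 1 = 1 := by
    have h := hωmul 1 1
    rw [mul_one] at h
    have h10 : ω 1 ≠ 0 := fun h0 => by simpa [h0] using hω1 1
    exact (mul_eq_left₀ h10).1 h.symm
  have h := hωmul k k⁻¹
  rw [mul_inv_cancel, h1] at h
  exact (eq_inv_of_mul_eq_one_right h.symm)

/-- **THE DICHOTOMY (ω-twisted)**: if `ψ` is right-`(K′, ω)`-equivariant and `χ`-isotypic under the norm-one Borel, and `ψ(β₀ w) ≠ 0` for some `β₀ ∈ B(𝔸)`, then **`χ(β₀₀) = ω(k)` whenever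
`β w = w k`** with `β ∈ B(𝔸)`, `k ∈ K′` (`ψ(β₀βw) = ψ(β₀wk) = ω(k)ψ(β₀w)` by equivariance, `= χ(β₀₀)ψ(β₀w)` by isotypy at the norm-one `β₀ββ₀⁻¹`). [cite: MoeglinWaldspurger1995, I.2.17] -/
theorem chi_firstEntryUnit_eq_kType_of_apply_ne_zero {K' : Subgroup (quasiSplit F E c 2).Adelic}
    (hHK' : ∀ (g k : (quasiSplit F E c 2).Adelic), k ∈ K' → borelHeight (g * k) = borelHeight g) (χ : HeckeCharacter E) {ω : ↥K' → ℂ}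
    {ψ : (quasiSplit F E c 2).Adelic → ℂ} (hψK : ∀ (g : (quasiSplit F E c 2).Adelic) (k : ↥K'), ψ (g * (k : (quasiSplit F E c 2).Adelic)) = ω k * ψ g)
    (hψχ : ∀ (b : (quasiSplit F E c 2).Adelic) (hb : b ∈ borelAdelic F E c 2), IdeleClassGroup.ideleNorm E (firstEntryUnit hb) = 1 →
      ∀ g, ψ (b * g) = ((χ (firstEntryUnit hb) : ℂˣ) : ℂ) * ψ g)
    {w β₀ : (quasiSplit F E c 2).Adelic} (hβ₀ : β₀ ∈ borelAdelic F E c 2) (hne : ψ (β₀ * w) ≠ 0)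
    {β : (quasiSplit F E c 2).Adelic} (hβ : β ∈ borelAdelic F E c 2) {k : (quasiSplit F E c 2).Adelic} (hk : k ∈ K') (h : β * w = w * k) :
    ((χ (firstEntryUnit hβ) : ℂˣ) : ℂ) = ω ⟨k, hk⟩ := by
  have hβ'' : β₀ * β * β₀⁻¹ ∈ borelAdelic F E c 2 := (borelAdelic F E c 2).mul_mem ((borelAdelic F E c 2).mul_mem hβ₀ hβ) ((borelAdelic F E c 2).inv_mem hβ₀)
  have hN : IdeleClassGroup.ideleNorm E (firstEntryUnit hβ'') = 1 := by
    rw [firstEntryUnit_conj hβ₀ hβ]; exact ideleNorm_firstEntryUnit_eq_one_of_mul_eq hHK' hβ hk h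
  have h1 : ψ (β₀ * β * w) = ω ⟨k, hk⟩ * ψ (β₀ * w) := by rw [mul_assoc, h, ← mul_assoc]; exact hψK _ ⟨k, hk⟩
  have h2 : ψ (β₀ * β * w) = ((χ (firstEntryUnit hβ) : ℂˣ) : ℂ) * ψ (β₀ * w) := by
    have h3 := hψχ _ hβ'' hN (β₀ * w)
    rw [firstEntryUnit_conj hβ₀ hβ] at h3
    rw [← h3]; congr 1; group
  rw [h1] at h2
  exact (mul_right_cancel₀ hne h2.symm)

/-- **WELL-DEFINEDNESS (ω-twisted)**: under the same hypotheses (`ω` multiplicative and unitary), `β w k = β' w k'` (`β, β' ∈ B(𝔸)`, `k, k' ∈ K′`) forces `χ(β₀₀)·ω(k) = χ(β'₀₀)·ω(k')`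
(`β⁻¹β' w = w k k'⁻¹`, the dichotomy, `d₀(β⁻¹β') = d₀(β)⁻¹ d₀(β')`). [cite: MoeglinWaldspurger1995, I.2.17] -/
theorem chi_mul_kType_eq_of_eq {K' : Subgroup (quasiSplit F E c 2).Adelic}
    (hHK' : ∀ (g k : (quasiSplit F E c 2).Adelic), k ∈ K' → borelHeight (g * k) = borelHeight g) (χ : HeckeCharacter E)
    {ω : ↥K' → ℂ} (hωmul : ∀ k k' : ↥K', ω (k * k') = ω k * ω k') (hω1 : ∀ k : ↥K', ‖ω k‖ = 1)
    {ψ : (quasiSplit F E c 2).Adelic → ℂ} (hψK : ∀ (g : (quasiSplit F E c 2).Adelic) (k : ↥K'), ψ (g * (k : (quasiSplit F E c 2).Adelic)) = ω k * ψ g)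
    (hψχ : ∀ (b : (quasiSplit F E c 2).Adelic) (hb : b ∈ borelAdelic F E c 2), IdeleClassGroup.ideleNorm E (firstEntryUnit hb) = 1 →
      ∀ g, ψ (b * g) = ((χ (firstEntryUnit hb) : ℂˣ) : ℂ) * ψ g)
    {w β₀ : (quasiSplit F E c 2).Adelic} (hβ₀ : β₀ ∈ borelAdelic F E c 2) (hne : ψ (β₀ * w) ≠ 0)
    {β β' k k' : (quasiSplit F E c 2).Adelic} (hβ : β ∈ borelAdelic F E c 2) (hβ' : β' ∈ borelAdelic F E c 2) (hk : k ∈ K') (hk' : k' ∈ K')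
    (h : β * w * k = β' * w * k') :
    ((χ (firstEntryUnit hβ) : ℂˣ) : ℂ) * ω ⟨k, hk⟩ = ((χ (firstEntryUnit hβ') : ℂˣ) : ℂ) * ω ⟨k', hk'⟩ := by
  have hq : β⁻¹ * β' * w = w * (k * k'⁻¹) := by
    calc β⁻¹ * β' * w = β⁻¹ * (β' * w * k') * k'⁻¹ := by group
      _ = β⁻¹ * (β * w * k) * k'⁻¹ := by rw [h]
      _ = w * (k * k'⁻¹) := by group
  have h1 := chi_firstEntryUnit_eq_kType_of_apply_ne_zero hHK' χ hψK hψχ hβ₀ hne ((borelAdelic F E c 2).mul_mem ((borelAdelic F E c 2).inv_mem hβ) hβ')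
    (K'.mul_mem hk (K'.inv_mem hk')) hq
  have hkk : (⟨k * k'⁻¹, K'.mul_mem hk (K'.inv_mem hk')⟩ : ↥K') = ⟨k, hk⟩ * ⟨k', hk'⟩⁻¹ := rfl
  rw [firstEntryUnit_inv_mul hβ hβ', map_mul, map_inv, Units.val_mul, Units.val_inv_eq_inv_val, hkk, hωmul, kType_inv hωmul hω1] at h1
  have hk'0 : ω ⟨k', hk'⟩ ≠ 0 := fun h0 => by simpa [h0] using hω1 ⟨k', hk'⟩
  have hχ0 : ((χ (firstEntryUnit hβ) : ℂˣ) : ℂ) ≠ 0 := Units.ne_zero _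
  rw [show ω ⟨k, hk⟩ = ω ⟨k, hk⟩ * (ω ⟨k', hk'⟩)⁻¹ * ω ⟨k', hk'⟩ from (inv_mul_cancel_right₀ hk'0 _).symm, ← h1, ← mul_assoc, ← mul_assoc,
    mul_inv_cancel₀ hχ0, one_mul]


/-! ## §2 One double coset: `ψ|_{B(𝔸) w K′} = f_w(H)·φ_w` -/

/-- **ONE DOUBLE COSET (ω-twisted)**: on `d = B(𝔸) w K′` a continuous, right-`(K′, ω)`-equivariant, norm-one-Borel `χ`-isotypic `ψ` supported in a height band is `f(H)·φ` with
`f ∈ C_c((0,∞))` continuous and `φ ∈ chiSectionSpace χ K′ ω` continuous and vanishing off `d` (`φ(βwk) = χ(β₀₀)·ω(k)`, construction (i)–(iii) of the module docstring; ★ `exists_torusRay_two`).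
[cite: MoeglinWaldspurger1995, I.2.17, II.1.1] [cite: GelbartJacquet1979Corvallis, §3] -/
theorem exists_pureTensor_on_doubleCoset_kType (hc : c * c = 1) {K' : Subgroup (quasiSplit F E c 2).Adelic} (hK'o : IsOpen (K' : Set (quasiSplit F E c 2).Adelic))
    (hHK' : ∀ (g k : (quasiSplit F E c 2).Adelic), k ∈ K' → borelHeight (g * k) = borelHeight g)
    (χ : HeckeCharacter E) (hχray : ∀ r : ℝ≥0ˣ, χ (posRealIdele E r) = 1)
    {ω : ↥K' → ℂ} (hωmul : ∀ k k' : ↥K', ω (k * k') = ω k * ω k') (hω1 : ∀ k : ↥K', ‖ω k‖ = 1) (hωc : Continuous ω)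
    {ψ : (quasiSplit F E c 2).Adelic → ℂ} (hψc : Continuous ψ) (hψK : ∀ (g : (quasiSplit F E c 2).Adelic) (k : ↥K'), ψ (g * (k : (quasiSplit F E c 2).Adelic)) = ω k * ψ g)
    (hψχ : ∀ (b : (quasiSplit F E c 2).Adelic) (hb : b ∈ borelAdelic F E c 2), IdeleClassGroup.ideleNorm E (firstEntryUnit hb) = 1 →
      ∀ g, ψ (b * g) = ((χ (firstEntryUnit hb) : ℂˣ) : ℂ) * ψ g)
    {a b : ℝ≥0} (ha : 0 < a) (hband : ∀ g, ψ g ≠ 0 → a ≤ borelHeight g ∧ borelHeight g ≤ b) (w : (quasiSplit F E c 2).Adelic) :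
    ∃ (f : ℝ → ℂ) (φ : (quasiSplit F E c 2).Adelic → ℂ), Continuous f ∧ HasCompactSupport f ∧ tsupport f ⊆ Ioi 0 ∧ φ ∈ chiSectionSpace χ K' ω ∧ Continuous φ ∧
      (∀ g, g ∉ DoubleCoset.doubleCoset w (borelAdelic F E c 2 : Set (quasiSplit F E c 2).Adelic) K' → φ g = 0) ∧
      ∀ g ∈ DoubleCoset.doubleCoset w (borelAdelic F E c 2 : Set (quasiSplit F E c 2).Adelic) K', ψ g = f (borelHeight g) * φ g := by
  classical
  by_cases hvan : ∀ g ∈ DoubleCoset.doubleCoset w (borelAdelic F E c 2 : Set (quasiSplit F E c 2).Adelic) K', ψ g = 0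
  · refine ⟨0, 0, continuous_const, HasCompactSupport.of_support_subset_isCompact isCompact_empty (by simp), by simp [tsupport], Submodule.zero_mem _,
      continuous_const, fun _ _ => rfl, fun g hg => by simp [hvan g hg]⟩
  simp only [not_forall, exists_prop] at hvan
  obtain ⟨g₀, hg₀, hψg₀⟩ := hvan
  obtain ⟨β₀, hβ₀, k₀, hk₀, hg₀eq⟩ := DoubleCoset.mem_doubleCoset.1 hg₀
  have hne : ψ (β₀ * w) ≠ 0 := by
    rw [hg₀eq, hψK _ ⟨k₀, hk₀⟩] at hψg₀
    exact right_ne_zero_of_mul hψg₀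
  -- the diagonal ray
  obtain ⟨ρ, hρc, -, hρd, -⟩ := exists_torusRay_two (F := F) (E := E) (c := c) hc
  set D : ℝ := (Module.finrank ℚ E : ℝ) with hD
  have hDpos : 0 < D := by rw [hD]; exact_mod_cast Module.finrank_pos
  have hρB : ∀ s, (((ρ s : torusInBorel F E c 2) : borelAdelic F E c 2) : (quasiSplit F E c 2).Adelic) ∈ borelAdelic F E c 2 := fun s => ((ρ s : torusInBorel F E c 2) : borelAdelic F E c 2).2
  have hρfe : ∀ s, firstEntryUnit (hρB s) = posRealIdele E (expUnitNNReal s) := fun s => by rw [firstEntryUnit_eq_diagUnit_zero]; exact hρd s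
  have hρN : ∀ s, IdeleClassGroup.ideleNorm E (firstEntryUnit (hρB s)) = ((expUnitNNReal (Module.finrank ℚ E * s) : ℝ≥0ˣ) : ℝ≥0) := fun s => by
    rw [hρfe, UnitaryGroup.ideleNorm_posRealIdele_expUnitNNReal]
  have hχρ : ∀ s, ((χ (firstEntryUnit (hρB s)) : ℂˣ) : ℂ) = 1 := fun s => by rw [hρfe, hχray, Units.val_one]
  have hHρ : ∀ (s : ℝ) (g : (quasiSplit F E c 2).Adelic), (borelHeight ((((ρ s : torusInBorel F E c 2) : borelAdelic F E c 2) : (quasiSplit F E c 2).Adelic) * g) : ℝ) =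
      Real.exp (D * s) * borelHeight g := fun s g => by
    rw [borelHeight_borel_mul_eq_ideleNorm_firstEntryUnit_mul (hρB s), hρN s, NNReal.coe_mul]
    rfl
  -- the functions
  set f : ℝ → ℂ := fun h => if 0 < h then ψ ((((ρ (Real.log (h / borelHeight w) / D) : torusInBorel F E c 2) : borelAdelic F E c 2) : (quasiSplit F E c 2).Adelic) * w) else 0 with hf
  set φ : (quasiSplit F E c 2).Adelic → ℂ := fun g =>
    if hg : g ∈ DoubleCoset.doubleCoset w (borelAdelic F E c 2 : Set (quasiSplit F E c 2).Adelic) K' then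
      ((χ (firstEntryUnit (DoubleCoset.mem_doubleCoset.1 hg).choose_spec.1) : ℂˣ) : ℂ) *
        ω ⟨(DoubleCoset.mem_doubleCoset.1 hg).choose_spec.2.choose, (DoubleCoset.mem_doubleCoset.1 hg).choose_spec.2.choose_spec.1⟩ else 0 with hφ
  -- evaluation of `φ` on any representation
  have hφev : ∀ (β : (quasiSplit F E c 2).Adelic) (hβ : β ∈ borelAdelic F E c 2) (k : (quasiSplit F E c 2).Adelic) (hk : k ∈ K'),
      φ (β * w * k) = ((χ (firstEntryUnit hβ) : ℂˣ) : ℂ) * ω ⟨k, hk⟩ := fun β hβ k hk => by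
    have hg : β * w * k ∈ DoubleCoset.doubleCoset w (borelAdelic F E c 2 : Set (quasiSplit F E c 2).Adelic) K' := DoubleCoset.mem_doubleCoset.2 ⟨β, hβ, k, hk, rfl⟩
    simp only [hφ, dif_pos hg]
    have hspec := (DoubleCoset.mem_doubleCoset.1 hg).choose_spec
    exact (chi_mul_kType_eq_of_eq hHK' χ hωmul hω1 hψK hψχ hβ₀ hne hβ hspec.1 hk hspec.2.choose_spec.1 hspec.2.choose_spec.2).symm
  have hφK : ∀ (g : (quasiSplit F E c 2).Adelic) (k : ↥K'), φ (g * (k : (quasiSplit F E c 2).Adelic)) = ω k * φ g := fun g k => by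
    by_cases hg : g ∈ DoubleCoset.doubleCoset w (borelAdelic F E c 2 : Set (quasiSplit F E c 2).Adelic) K'
    · obtain ⟨β, hβ, k', hk', rfl⟩ := DoubleCoset.mem_doubleCoset.1 hg
      rw [mul_assoc (β * w), hφev β hβ _ (K'.mul_mem hk' k.2), hφev β hβ _ hk',
        show (⟨k' * (k : (quasiSplit F E c 2).Adelic), K'.mul_mem hk' k.2⟩ : ↥K') = ⟨k', hk'⟩ * k from rfl, hωmul]
      ring
    · have hgk : g * (k : (quasiSplit F E c 2).Adelic) ∉ DoubleCoset.doubleCoset w (borelAdelic F E c 2 : Set (quasiSplit F E c 2).Adelic) K' := fun hmem => hg (by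
        obtain ⟨x, hx, y, hy, hxy⟩ := DoubleCoset.mem_doubleCoset.1 hmem
        exact DoubleCoset.mem_doubleCoset.2 ⟨x, hx, y * (k : (quasiSplit F E c 2).Adelic)⁻¹, K'.mul_mem hy (K'.inv_mem k.2), by
          rw [← mul_assoc, ← hxy, mul_inv_cancel_right]⟩)
      simp only [hφ, dif_neg hg, dif_neg hgk, mul_zero]
  have hφoff : ∀ g, g ∉ DoubleCoset.doubleCoset w (borelAdelic F E c 2 : Set (quasiSplit F E c 2).Adelic) K' → φ g = 0 := fun g hg => by simp only [hφ, dif_neg hg]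
  -- the height of `ρ(s_h) w` is `h`
  have hHw : ∀ h : ℝ, 0 < h → (borelHeight ((((ρ (Real.log (h / borelHeight w) / D) : torusInBorel F E c 2) : borelAdelic F E c 2) : (quasiSplit F E c 2).Adelic) * w) : ℝ) = h :=
    fun h hh => by
    have hw : (0 : ℝ) < borelHeight w := borelHeight_pos w
    rw [hHρ, mul_div_cancel₀ _ hDpos.ne', Real.exp_log (div_pos hh hw), div_mul_cancel₀ _ hw.ne']
  -- `f` vanishes below `a` and above `b`
  have hfzero : ∀ h : ℝ, (h < a ∨ (b : ℝ) < h) → f h = 0 := fun h hh => by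
    simp only [hf]
    split_ifs with hpos
    · by_contra hψ
      have hb := hband _ hψ
      have hH := hHw h hpos
      rcases hh with hlt | hgt
      · have h1 : ((a : ℝ≥0) : ℝ) ≤ h := by rw [← hH]; exact_mod_cast hb.1
        exact absurd hlt (not_lt.2 h1)
      · have h1 : h ≤ ((b : ℝ≥0) : ℝ) := by rw [← hH]; exact_mod_cast hb.2
        exact absurd hgt (not_lt.2 h1)
    · rfl
  have hfc : Continuous f := by
    refine continuous_iff_continuousAt.2 fun h₀ => ?_
    by_cases h₀pos : 0 < h₀
    · have hF : ContinuousAt (fun h : ℝ => ψ ((((ρ (Real.log (h / borelHeight w) / D) : torusInBorel F E c 2) : borelAdelic F E c 2) : (quasiSplit F E c 2).Adelic) * w)) h₀ := by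
        have hw : (0 : ℝ) < borelHeight w := borelHeight_pos w
        have h1 : ContinuousAt (fun h : ℝ => h / (borelHeight w : ℝ)) h₀ := continuousAt_id.div_const _
        have h2 : ContinuousAt Real.log ((fun h : ℝ => h / (borelHeight w : ℝ)) h₀) := Real.continuousAt_log (div_pos h₀pos hw).ne'
        have hlog : ContinuousAt (fun h : ℝ => Real.log (h / borelHeight w) / D) h₀ := by
          have h3 := (ContinuousAt.comp (f := fun h : ℝ => h / (borelHeight w : ℝ)) (g := Real.log) h2 h1).div_const D
          simpa only [Function.comp_def] using h3
        exact (hψc.continuousAt).comp ((((continuous_subtype_val.comp continuous_subtype_val).comp hρc).continuousAt.comp hlog).mul continuousAt_const)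
      refine hF.congr (Filter.eventuallyEq_of_mem (Ioi_mem_nhds h₀pos) fun h hh => ?_)
      simp only [hf, if_pos (show 0 < h from hh)]
    · refine (continuousAt_const (y := (0 : ℂ))).congr (Filter.eventuallyEq_of_mem (Iio_mem_nhds (show h₀ < (a : ℝ) from (not_lt.1 h₀pos).trans_lt (by exact_mod_cast ha))) ?_)
      intro h hh
      exact (hfzero h (Or.inl hh)).symm
  have hfsupp : Function.support f ⊆ Icc (a : ℝ) b := fun h hh => by
    by_contra hI
    rw [mem_Icc, not_and_or, not_le, not_le] at hI
    exact hh (hfzero h hI)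
  refine ⟨f, φ, hfc, HasCompactSupport.of_support_subset_isCompact isCompact_Icc hfsupp,
    (closure_minimal hfsupp isClosed_Icc).trans fun h hh => lt_of_lt_of_le (by exact_mod_cast ha) hh.1, ?_, continuous_of_mul_kType_isOpen hK'o hωc hφK, hφoff, ?_⟩
  · -- `φ ∈ chiSectionSpace χ K′ ω`
    refine (mem_chiSectionSpace_iff φ).2 ⟨fun b' hb' g => ?_, fun g k => hφK g k⟩
    by_cases hg : g ∈ DoubleCoset.doubleCoset w (borelAdelic F E c 2 : Set (quasiSplit F E c 2).Adelic) K'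
    · obtain ⟨β, hβ, k, hk, rfl⟩ := DoubleCoset.mem_doubleCoset.1 hg
      rw [show b' * (β * w * k) = b' * β * w * k by simp only [mul_assoc], hφev _ ((borelAdelic F E c 2).mul_mem hb' hβ) k hk, hφev β hβ k hk,
        firstEntryUnit_mul hb' hβ, map_mul, Units.val_mul, mul_assoc]
    · have hbg : b' * g ∉ DoubleCoset.doubleCoset w (borelAdelic F E c 2 : Set (quasiSplit F E c 2).Adelic) K' := fun hmem => hg (by
        obtain ⟨x, hx, y, hy, hxy⟩ := DoubleCoset.mem_doubleCoset.1 hmem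
        exact DoubleCoset.mem_doubleCoset.2 ⟨b'⁻¹ * x, (borelAdelic F E c 2).mul_mem ((borelAdelic F E c 2).inv_mem hb') hx, y, hy, by
          rw [mul_assoc b'⁻¹, mul_assoc b'⁻¹, ← hxy, inv_mul_cancel_left]⟩)
      rw [hφoff _ hg, hφoff _ hbg, mul_zero]
  · -- the identity on the double coset
    intro g hg
    obtain ⟨β, hβ, k, hk, rfl⟩ := DoubleCoset.mem_doubleCoset.1 hg
    rw [hφev β hβ k hk, hψK _ ⟨k, hk⟩, hHK' _ _ hk]
    -- `β = β₁ ρ(s)`, `e^{Ds} = ‖β₀₀‖`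
    set nβ : ℝ≥0 := IdeleClassGroup.ideleNorm E (firstEntryUnit hβ) with hnβ
    have hnβpos : (0 : ℝ) < nβ := by
      have h := borelHeight_borel_mul_eq_ideleNorm_firstEntryUnit_mul hβ w
      have h1 : nβ * borelHeight w ≠ 0 := by rw [hnβ, ← h]; exact (borelHeight_pos _).ne'
      have h2 : nβ ≠ 0 := left_ne_zero_of_mul h1
      exact_mod_cast pos_iff_ne_zero.2 h2
    set s : ℝ := Real.log nβ / D with hs
    have hexp : Real.exp (D * s) = nβ := by rw [hs, mul_div_cancel₀ _ hDpos.ne', Real.exp_log hnβpos]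
    have hexpU : ((expUnitNNReal (Module.finrank ℚ E * s) : ℝ≥0ˣ) : ℝ≥0) = nβ := NNReal.eq hexp
    -- `β₁ := β ρ(s)⁻¹` is norm-one
    have hβ₁ : β * ((((ρ s : torusInBorel F E c 2) : borelAdelic F E c 2) : (quasiSplit F E c 2).Adelic))⁻¹ ∈ borelAdelic F E c 2 :=
      (borelAdelic F E c 2).mul_mem hβ ((borelAdelic F E c 2).inv_mem (hρB s))
    have hfe₁ : firstEntryUnit hβ₁ = firstEntryUnit hβ * (firstEntryUnit (hρB s))⁻¹ := by
      rw [show firstEntryUnit hβ₁ = firstEntryUnit ((borelAdelic F E c 2).mul_mem hβ ((borelAdelic F E c 2).inv_mem (hρB s))) from rfl,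
        firstEntryUnit_mul hβ ((borelAdelic F E c 2).inv_mem (hρB s)), firstEntryUnit_inv (hρB s)]
    have hN₁ : IdeleClassGroup.ideleNorm E (firstEntryUnit hβ₁) = 1 := by
      rw [hfe₁, map_mul, map_inv, hρN s, hexpU, ← hnβ, mul_inv_cancel₀ (ne_of_gt (by exact_mod_cast hnβpos))]
    have hχ₁ : ((χ (firstEntryUnit hβ₁) : ℂˣ) : ℂ) = ((χ (firstEntryUnit hβ) : ℂˣ) : ℂ) := by
      rw [hfe₁, map_mul, map_inv, Units.val_mul, Units.val_inv_eq_inv_val, hχρ s, inv_one, mul_one]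
    -- `ψ(β w) = χ(β₀₀) ψ(ρ(s) w)`
    have hψβ : ψ (β * w) = ((χ (firstEntryUnit hβ) : ℂˣ) : ℂ) * ψ ((((ρ s : torusInBorel F E c 2) : borelAdelic F E c 2) : (quasiSplit F E c 2).Adelic) * w) := by
      have h1 := hψχ _ hβ₁ hN₁ ((((ρ s : torusInBorel F E c 2) : borelAdelic F E c 2) : (quasiSplit F E c 2).Adelic) * w)
      rw [hχ₁, ← mul_assoc, inv_mul_cancel_right] at h1
      exact h1
    -- `f(H(βw)) = ψ(ρ(s) w)`
    have hHβw : ((borelHeight (β * w) : ℝ≥0) : ℝ) = nβ * borelHeight w := by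
      rw [borelHeight_borel_mul_eq_ideleNorm_firstEntryUnit_mul hβ w, NNReal.coe_mul]
    have hpos : (0 : ℝ) < borelHeight (β * w) := borelHeight_pos _
    have hfval : f (borelHeight (β * w)) = ψ ((((ρ s : torusInBorel F E c 2) : borelAdelic F E c 2) : (quasiSplit F E c 2).Adelic) * w) := by
      simp only [hf, if_pos hpos]
      have hw : (borelHeight w : ℝ) ≠ 0 := NNReal.coe_ne_zero.2 (borelHeight_pos w).ne'
      rw [hHβw, mul_div_cancel_right₀ _ hw]
    rw [hfval, hψβ]
    ring

/-! ## §3 The decomposition -/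

/-- **THE PURE-TENSOR DECOMPOSITION (ω-twisted), WITH TERMWISE DOMINATION**: with finitely many `(B(𝔸), K′)`-double cosets (`hBK`), a continuous right-`(K′, ω)`-equivariant
norm-one-Borel `χ`-isotypic `ψ` supported in a height band is a FINITE SUM `ψ(g) = Σ_i f_i(H(g))·φ_i(g)` with `f_i` continuous, compactly supported in `(0,∞)`, `φ_i ∈ chiSectionSpace χ K′ ω`
continuous, and `|f_i(H(g)) φ_i(g)| ≤ |ψ(g)|` termwise (each term is `ψ` on its own double coset and `0` elsewhere) — the generators of the C7_τ HEAD_τ.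
[cite: MoeglinWaldspurger1995, I.2.17, II.1.1] [cite: GelbartJacquet1979Corvallis, §3] -/
theorem exists_sum_pureTensor_eq_norm_le_kType (hc : c * c = 1) {K' : Subgroup (quasiSplit F E c 2).Adelic} (hK'o : IsOpen (K' : Set (quasiSplit F E c 2).Adelic))
    (hHK' : ∀ (g k : (quasiSplit F E c 2).Adelic), k ∈ K' → borelHeight (g * k) = borelHeight g)
    (hBK : ∃ W : Finset (quasiSplit F E c 2).Adelic, ∀ g : (quasiSplit F E c 2).Adelic, ∃ β ∈ borelAdelic F E c 2, ∃ w ∈ W, ∃ k ∈ K', g = β * w * k)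
    (χ : HeckeCharacter E) (hχray : ∀ r : ℝ≥0ˣ, χ (posRealIdele E r) = 1)
    {ω : ↥K' → ℂ} (hωmul : ∀ k k' : ↥K', ω (k * k') = ω k * ω k') (hω1 : ∀ k : ↥K', ‖ω k‖ = 1) (hωc : Continuous ω)
    {ψ : (quasiSplit F E c 2).Adelic → ℂ} (hψc : Continuous ψ) (hψK : ∀ (g : (quasiSplit F E c 2).Adelic) (k : ↥K'), ψ (g * (k : (quasiSplit F E c 2).Adelic)) = ω k * ψ g)
    (hψχ : ∀ (b : (quasiSplit F E c 2).Adelic) (hb : b ∈ borelAdelic F E c 2), IdeleClassGroup.ideleNorm E (firstEntryUnit hb) = 1 →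
      ∀ g, ψ (b * g) = ((χ (firstEntryUnit hb) : ℂˣ) : ℂ) * ψ g)
    {a b : ℝ≥0} (ha : 0 < a) (hband : ∀ g, ψ g ≠ 0 → a ≤ borelHeight g ∧ borelHeight g ≤ b) :
    ∃ (ι : Type) (_ : Fintype ι) (f : ι → ℝ → ℂ) (φ : ι → (quasiSplit F E c 2).Adelic → ℂ),
      (∀ i, Continuous (f i) ∧ HasCompactSupport (f i) ∧ tsupport (f i) ⊆ Ioi 0 ∧ φ i ∈ chiSectionSpace χ K' ω ∧ Continuous (φ i) ∧
        ∀ g, ‖f i (borelHeight g) * φ i g‖ ≤ ‖ψ g‖) ∧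
      ∀ g, ψ g = ∑ i, f i (borelHeight g) * φ i g := by
  classical
  obtain ⟨W, hW⟩ := hBK
  set Q : Finset (DoubleCoset.Quotient (borelAdelic F E c 2 : Set (quasiSplit F E c 2).Adelic) (K' : Set (quasiSplit F E c 2).Adelic)) :=
    W.image (fun w => DoubleCoset.mk (borelAdelic F E c 2) K' w) with hQ
  have hD := fun q : ↥Q => exists_pureTensor_on_doubleCoset_kType hc hK'o hHK' χ hχray hωmul hω1 hωc hψc hψK hψχ ha hband (q.1.out : (quasiSplit F E c 2).Adelic)
  choose f φ hf hfs hf0 hφV hφc hφoff hψeq using hD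
  refine ⟨↥Q, inferInstance, f, φ, fun q => ⟨hf q, hfs q, hf0 q, hφV q, hφc q, fun g => ?_⟩, fun g => ?_⟩
  · by_cases hg : g ∈ DoubleCoset.doubleCoset (q.1.out : (quasiSplit F E c 2).Adelic) (borelAdelic F E c 2 : Set (quasiSplit F E c 2).Adelic) K'
    · rw [← hψeq q g hg]
    · rw [hφoff q g hg, mul_zero, norm_zero]; exact norm_nonneg _
  -- the class of `g`
  obtain ⟨β, hβ, w, hw, k, hk, hgeq⟩ := hW g
  have hgq : DoubleCoset.mk (borelAdelic F E c 2) K' g ∈ Q := by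
    rw [hQ, Finset.mem_image]
    exact ⟨w, hw, (DoubleCoset.eq _ _ w g).2 ⟨β, hβ, k, hk, hgeq⟩⟩
  set q₀ : ↥Q := ⟨DoubleCoset.mk (borelAdelic F E c 2) K' g, hgq⟩ with hq₀
  have hmem : ∀ q : ↥Q, g ∈ DoubleCoset.doubleCoset (q.1.out : (quasiSplit F E c 2).Adelic) (borelAdelic F E c 2 : Set (quasiSplit F E c 2).Adelic) K' ↔ q = q₀ := fun q => by
    rw [DoubleCoset.mem_doubleCoset]
    constructor
    · rintro ⟨x, hx, y, hy, hxy⟩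
      apply Subtype.ext
      rw [hq₀]
      show q.1 = DoubleCoset.mk (borelAdelic F E c 2) K' g
      rw [← DoubleCoset.out_eq' _ _ q.1]
      exact (DoubleCoset.eq _ _ _ g).2 ⟨x, hx, y, hy, hxy⟩
    · rintro rfl
      have h := (DoubleCoset.eq (borelAdelic F E c 2) K' (q₀.1.out) g).1 (by rw [DoubleCoset.out_eq'])
      obtain ⟨x, hx, y, hy, hxy⟩ := h
      exact ⟨x, hx, y, hy, hxy⟩
  rw [Finset.sum_eq_single q₀ (fun q _ hq => by rw [hφoff q g (fun hm => hq ((hmem q).1 hm)), mul_zero]) (fun hq => absurd (Finset.mem_univ q₀) hq)]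
  exact hψeq q₀ g ((hmem q₀).2 rfl)

end Summit.HodgeConjecture.HodgeConjecture.Cruxes.H413.K2E1PseudoEisensteinChiSectionStabiliserKTypeU2

end
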